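import Literature.Probability.LatticeModels.PlaneRotatorLRO
import Literature.Probability.LatticeModels.NVectorInfraredBoundProofs
import Literature.Probability.LatticeModels.LatticeGreenRiemannSum
import HarnessLib

/-!
# Long-range order of the three-dimensional plane rotator, proved (Friedli–Velenik 2017, Thm. 10.25)

Sibling proof file of `Literature.Probability.LatticeModels.PlaneRotatorLRO`, which vendors the
named fact `FriedliVelenik2017_thm1025_planeRotator3` (orientational long-range order of the
classical XY model on `(ℤ/Lℤ)³` at large coupling, in the angle parametrisation and `ε`-liminf
form). Here the fact is **discharged**:
`Literature.Probability.LatticeModels.FriedliVelenik2017_thm1025_planeRotator3_holds`.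

## Source and proof architecture

S. Friedli, Y. Velenik, *Statistical Mechanics of Lattice Systems*, CUP (2017), §10.5 (PDF pp.
499–503 of the held copy, read): Example 10.22 (p. 499: for `ρ` the uniform measure on the sphere,
`ℋ_{L;β} = 2β|ℰ_L| − 2β ∑ S_i·S_j`, i.e. the O(N) model at coupling `J = 2β` up to a constant),
§10.5.2 (pp. 500–502: Plancherel (10.39), (10.40), the display after Thm. 10.24
`⟨‖m_L‖²⟩_{L;β} ≥ 1 − (ν/4βd)|𝕋_L|⁻¹ ∑_{p≠0} {1 − (2d)⁻¹∑_{j∼0} cos(p·j)}⁻¹`, and the Riemann-sum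
limit (10.41) defining `β₀`), Thm. 10.25 (pp. 502–503, (10.42)). The printed proof is followed;
its two analytic engines are already theorems of the tree and are simply invoked:

1. **The finite-volume long-range-order bound** (display after Thm. 10.24, from the infrared bound
   Thm. 10.24 = Fröhlich–Simon–Spencer 1976 via Gaussian domination and Plancherel) is clause (2)
   of `FriedliVelenik2017_nVector_infraredBound_holds` (file `NVectorInfraredBoundProofs.lean`),
   for general `d`, `ν`, compactly supported single-spin law `ρ` with `‖S‖₂ = 1` a.s., even
   `L ≥ 4`: `⟨‖m_L‖²⟩ ≥ 1 − (ν/4β) L^{-d} ∑_{k≠0} ε(2πk/L)⁻¹`, `ε(p) = ∑ᵢ(1 − cos pᵢ) = d{…}`.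
2. **The Riemann sum** `L^{-d}∑_{k≠0} ε(2πk/L)⁻¹ = torusGreen 0 → latticeGreen 0 =
   ∫_{[-π,π]^d} ε(p)⁻¹ dp/(2π)^d` for `d ≥ 3` along even `L` ((10.41); finiteness of `β₀`,
   Thm. B.72/Cor. B.73 of the book) is `torusGreen_tendsto_latticeGreen`
   (file `LatticeGreenRiemannSum.lean`).
3. **This file** supplies the change of variables of Example 10.22 (no new definitions; all
   objects are explicit Mathlib terms): for a single-spin map `u : ℝ → ℝ^ν` on the angle interval
   `[0, 2π]`, the law `u_* Leb|_{[0,2π]}` is a nonzero, finite, compactly supported measure on `ℝ^ν`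
   (`map_angleLaw_ne_zero`, `exists_isCompact_map_angleLaw`, `ae_map_angleLaw`) and the product
   reference measure `⊗_x u_* Leb|_{[0,2π]}` is the push-forward of Lebesgue measure on the angle
   cube `[0,2π]^{𝕋_L}` under `θ ↦ (u(θ_x))_x` (`nVectorRef_map_angleLaw`, Mathlib's
   `Measure.restrict_pi_pi` and `Measure.pi_map_pi`; `integral_nVectorRef_map_angleLaw`); for
   `u(t) = (cos t, sin t)`, `ν = 2`, `d = 3`, the identities
   `ℋ_{L;β}(S(θ)) = 6βL³ − 2β ∑_{(x,i)} cos(θ_{x+eᵢ} − θ_x)` (`nVectorHamiltonian_cosSin`) and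
   `‖m_L(S(θ))‖² = L⁻⁶ ∑_{x,y} cos(θ_x − θ_y)` (`magnetisationNormSq_cosSin`), whence the Gibbs
   expectation of `‖m_L‖²` at `β = J/2` is the plateau of the named fact
   (`integral_magnetisationNormSq_nVectorGibbs_cosSin`); and the assembly with
   `J₀ = 2β₀ = latticeGreen 0` (for `ν = 2`: `β₀ = (ν/4) latticeGreen 0`), whose positivity is read
   off the torus sums (`torusGreen_zero_ge`, each nonzero mode contributing at least `1/6`).

## References

* S. Friedli, Y. Velenik, *Statistical Mechanics of Lattice Systems: A Concrete Mathematical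
  Introduction*, Cambridge University Press (2017), doi:10.1017/9781316882603, §10.5.1 Example
  10.22, §10.5.2 (10.39)–(10.42), Thm. 10.24, Thm. 10.25, Remark 10.4. [FriedliVelenikSMLS2017]
* J. Fröhlich, B. Simon, T. Spencer, *Infrared bounds, phase transitions and continuous symmetry
  breaking*, Comm. Math. Phys. 50 (1976) 79–95 (original of Thm. 10.24; not re-read here).
-/

noncomputable section

open MeasureTheory Filter Finset
open scoped Real

namespace Literature.Probability.LatticeModels

namespace PlaneRotator

/-! ### Single-spin laws parametrised by an angle: `u_* Leb|_{[0,2π]}` -/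

section AngleLaw

variable {ν : ℕ} {u : ℝ → Fin ν → ℝ}

/-- The push-forward `u_* Leb|_{[0,2π]}` of Lebesgue measure on `[0, 2π]` under a measurable
single-spin map `u : ℝ → ℝ^ν` is not the zero measure (its total mass is `2π > 0`). [folklore] -/
theorem map_angleLaw_ne_zero (hu : Measurable u) :
    Measure.map u (volume.restrict (Set.Icc (0 : ℝ) (2 * π))) ≠ 0 := by
  intro h
  have h1 : Measure.map u (volume.restrict (Set.Icc (0 : ℝ) (2 * π))) Set.univ = 0 := by
    rw [h]
    rfl
  rw [Measure.map_apply hu MeasurableSet.univ, Set.preimage_univ, Measure.restrict_apply_univ,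
    Real.volume_Icc, sub_zero] at h1
  exact absurd h1 (ENNReal.ofReal_pos.2 (by positivity)).ne'

/-- `u_* Leb|_{[0,2π]}` gives no mass to the complement of the (compact) image `u([0, 2π])`,
`u` continuous. [folklore] -/
theorem map_angleLaw_compl_image (hu : Continuous u) :
    Measure.map u (volume.restrict (Set.Icc (0 : ℝ) (2 * π))) (u '' Set.Icc 0 (2 * π))ᶜ = 0 := by
  rw [Measure.map_apply hu.measurable (isCompact_Icc.image hu).isClosed.measurableSet.compl,
    Measure.restrict_apply' measurableSet_Icc]
  have : u ⁻¹' (u '' Set.Icc 0 (2 * π))ᶜ ∩ Set.Icc 0 (2 * π) = ∅ := by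
    ext t
    simp only [Set.mem_inter_iff, Set.mem_preimage, Set.mem_compl_iff, Set.mem_image,
      Set.mem_empty_iff_false, iff_false, not_and]
    intro h ht
    exact (h ⟨t, ht, rfl⟩).elim
  rw [this, measure_empty]

/-- `u_* Leb|_{[0,2π]}` is supported on a compact subset of `ℝ^ν` for `u` continuous (FV's standing
assumption of §10.5.1 on the reference measure `ρ`). [folklore] -/
theorem exists_isCompact_map_angleLaw (hu : Continuous u) :
    ∃ K : Set (Fin ν → ℝ), IsCompact K ∧
      Measure.map u (volume.restrict (Set.Icc (0 : ℝ) (2 * π))) Kᶜ = 0 :=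
  ⟨u '' Set.Icc 0 (2 * π), isCompact_Icc.image hu, map_angleLaw_compl_image hu⟩

/-- A property holding at every `u t` holds `u_* Leb|_{[0,2π]}`-almost surely. [folklore] -/
theorem ae_map_angleLaw (hu : Continuous u) {p : (Fin ν → ℝ) → Prop} (hp : ∀ t, p (u t)) :
    ∀ᵐ s ∂(Measure.map u (volume.restrict (Set.Icc (0 : ℝ) (2 * π)))), p s := by
  have hmem : ∀ᵐ s ∂(Measure.map u (volume.restrict (Set.Icc (0 : ℝ) (2 * π)))),
      s ∈ u '' Set.Icc 0 (2 * π) :=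
    mem_ae_iff.2 (map_angleLaw_compl_image hu)
  filter_upwards [hmem] with s hs
  obtain ⟨t, -, rfl⟩ := hs
  exact hp t

variable {d L : ℕ}

/-- A continuous function is integrable on the (compact) angle cube `[0,2π]^{𝕋_L}`. [folklore] -/
theorem integrableOn_angleCube [NeZero L] {f : (TorusSite d L → ℝ) → ℝ} (hf : Continuous f) :
    IntegrableOn f (Set.pi Set.univ fun _ => Set.Icc (0 : ℝ) (2 * π)) volume :=
  hf.continuousOn.integrableOn_compact (isCompact_univ_pi fun _ => isCompact_Icc)

/-- **The reference measure `⊗_x u_* Leb|_{[0,2π]}` is the push-forward of Lebesgue measure on the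
angle cube `[0,2π]^{𝕋_L}` under `θ ↦ (u(θ_x))_x`** (reflecting `μ₀ = ⊗_{i ∈ 𝕋_L} ρ` of FV §10.5.1;
Mathlib's `Measure.restrict_pi_pi` and `Measure.pi_map_pi`). [folklore] -/
theorem nVectorRef_map_angleLaw [NeZero L] (hu : Measurable u) :
    nVectorRef (d := d) (L := L) (Measure.map u (volume.restrict (Set.Icc (0 : ℝ) (2 * π)))) =
      ((volume : Measure (TorusSite d L → ℝ)).restrict
          (Set.pi Set.univ fun _ => Set.Icc (0 : ℝ) (2 * π))).map fun θ x => u (θ x) := by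
  rw [nVectorRef, volume_pi, Measure.restrict_pi_pi, Measure.pi_map_pi fun _ => hu.aemeasurable]

/-- **Change of variables**: `∫ F d(⊗_x u_* Leb|_{[0,2π]}) = ∫_{[0,2π]^{𝕋_L}} F((u(θ_x))_x) dθ` for
continuous `F`. [folklore] -/
theorem integral_nVectorRef_map_angleLaw [NeZero L] (hu : Continuous u) (F : VecConfig d L ν → ℝ)
    (hF : Continuous F) :
    ∫ ω, F ω ∂(nVectorRef (d := d) (L := L)
        (Measure.map u (volume.restrict (Set.Icc (0 : ℝ) (2 * π))))) =
      ∫ θ in Set.pi Set.univ fun _ => Set.Icc (0 : ℝ) (2 * π), F fun x => u (θ x) := by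
  rw [nVectorRef_map_angleLaw hu.measurable]
  have hc : Continuous fun (θ : TorusSite d L → ℝ) (x : TorusSite d L) => u (θ x) :=
    continuous_pi fun x => hu.comp (continuous_apply x)
  exact integral_map hc.measurable.aemeasurable hF.aestronglyMeasurable

end AngleLaw

/-! ### The plane rotator: `u(t) = (cos t, sin t)`, `ν = 2`, `d = 3` (FV Example 10.22) -/

section CosSin

variable {L : ℕ}

/-- `t ↦ (cos t, sin t)` is continuous. [folklore] -/
theorem continuous_cosSin : Continuous fun t : ℝ => (![Real.cos t, Real.sin t] : Fin 2 → ℝ) := by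
  fun_prop

/-- `‖(cos t, sin t)‖₂² = 1`. [folklore] -/
theorem sum_cosSin_sq (t : ℝ) : ∑ a, (![Real.cos t, Real.sin t] : Fin 2 → ℝ) a ^ 2 = 1 := by
  simp [Fin.sum_univ_two, Real.cos_sq_add_sin_sq]

/-- `‖(cos s, sin s) − (cos t, sin t)‖₂² = 2 − 2 cos(s − t)` (FV Example 10.22:
`‖S_i − S_j‖² = 2 − 2 S_i·S_j` for unit spins). [cite: FriedliVelenikSMLS2017, §10.5.1 Example 10.22] -/
theorem sum_cosSin_sub_sq (s t : ℝ) :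
    ∑ a, ((![Real.cos s, Real.sin s] : Fin 2 → ℝ) a -
        (![Real.cos t, Real.sin t] : Fin 2 → ℝ) a) ^ 2 = 2 - 2 * Real.cos (s - t) := by
  simp only [Fin.sum_univ_two, Matrix.cons_val_zero, Matrix.cons_val_one, Matrix.cons_val_fin_one,
    Real.cos_sub]
  linear_combination Real.cos_sq_add_sin_sq s + Real.cos_sq_add_sin_sq t

/-- **Example 10.22 for `N = 2`, `d = 3`**: `ℋ_{L;β}((cos θ_x, sin θ_x)_x) =
6βL³ − 2β ∑_{(x,i)} cos(θ_{x+eᵢ} − θ_x)` (each of the `3L³` bonds `{x, x + eᵢ}` contributes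
`‖S_i − S_j‖² = 2 − 2cos(θ_i − θ_j)`). [cite: FriedliVelenikSMLS2017, §10.5.1 Example 10.22] -/
theorem nVectorHamiltonian_cosSin [NeZero L] (β : ℝ) (θ : TorusSite 3 L → ℝ) :
    nVectorHamiltonian β (fun x => (![Real.cos (θ x), Real.sin (θ x)] : Fin 2 → ℝ)) =
      6 * β * (L : ℝ) ^ 3 -
        2 * β * ∑ b : TorusSite 3 L × Fin 3, Real.cos (θ (b.1 + Pi.single b.2 1) - θ b.1) := by
  unfold nVectorHamiltonian
  simp_rw [sum_cosSin_sub_sq]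
  rw [Fintype.sum_prod_type]
  dsimp only
  have h : ∀ x : TorusSite 3 L, ∑ i : Fin 3, (2 - 2 * Real.cos (θ (x + Pi.single i 1) - θ x)) =
      6 - 2 * ∑ i : Fin 3, Real.cos (θ (x + Pi.single i 1) - θ x) := by
    intro x
    rw [Finset.sum_sub_distrib, ← Finset.mul_sum]
    norm_num
  simp_rw [h]
  rw [Finset.sum_sub_distrib, ← Finset.mul_sum, Finset.sum_const, Finset.card_univ, nsmul_eq_mul,
    NVector.card_torusSite_real]
  ring

/-- `‖m_L((cos θ_x, sin θ_x)_x)‖₂² = L⁻⁶ ∑_{x,y} cos(θ_x − θ_y)` (the zero mode of §10.5.2 in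
angles). [folklore] -/
theorem magnetisationNormSq_cosSin [NeZero L] (θ : TorusSite 3 L → ℝ) :
    magnetisationNormSq (fun x => (![Real.cos (θ x), Real.sin (θ x)] : Fin 2 → ℝ)) =
      (∑ x : TorusSite 3 L, ∑ y : TorusSite 3 L, Real.cos (θ x - θ y)) / (L : ℝ) ^ 6 := by
  have hcos : ∑ x : TorusSite 3 L, ∑ y : TorusSite 3 L, Real.cos (θ x - θ y) =
      (∑ x, Real.cos (θ x)) * (∑ x, Real.cos (θ x)) +
        (∑ x, Real.sin (θ x)) * (∑ x, Real.sin (θ x)) := by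
    simp_rw [Real.cos_sub, Finset.sum_add_distrib]
    rw [Finset.sum_mul_sum, Finset.sum_mul_sum]
  unfold magnetisationNormSq
  simp only [Fin.sum_univ_two, Matrix.cons_val_zero, Matrix.cons_val_one, Matrix.cons_val_fin_one]
  rw [hcos]
  have hL6 : ((L : ℝ) ^ 3) ^ 2 = (L : ℝ) ^ 6 := by ring
  rw [div_pow, div_pow, hL6, ← add_div, sq, sq]

/-- **The Gibbs expectation of `‖m_L‖²` is the plateau of the named fact**: for the plane rotator
(single-spin law `(cos, sin)_* Leb|_{[0,2π]}`) at `β = J/2`,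
`⟨‖m_L‖²⟩_{L;J/2} = (Z L⁶)⁻¹ ∑_{x,y} ∫_{[0,2π]^{𝕋_L}} cos(θ_x − θ_y) e^{J∑cos(θ_{x+eᵢ}−θ_x)} dθ`
with `Z = ∫_{[0,2π]^{𝕋_L}} e^{J∑cos(θ_{x+eᵢ}−θ_x)} dθ` (the Boltzmann weight of (10.38) being
`e^{-3JL³}` times the XY weight, and the constant cancelling in the ratio).
[cite: FriedliVelenikSMLS2017, §10.5.1 Example 10.22 and §10.5.2] -/
theorem integral_magnetisationNormSq_nVectorGibbs_cosSin [NeZero L] {J : ℝ} (hJ : 0 < J) :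
    ∫ ω, magnetisationNormSq ω ∂(nVectorGibbs (d := 3) (L := L)
        (Measure.map (fun t : ℝ => (![Real.cos t, Real.sin t] : Fin 2 → ℝ))
          (volume.restrict (Set.Icc (0 : ℝ) (2 * π)))) (J / 2)) =
      (∑ x : TorusSite 3 L, ∑ y : TorusSite 3 L,
          ∫ θ in Set.pi Set.univ fun _ => Set.Icc (0 : ℝ) (2 * π), Real.cos (θ x - θ y) *
            Real.exp (J * ∑ b : TorusSite 3 L × Fin 3,
              Real.cos (θ (b.1 + Pi.single b.2 1) - θ b.1))) /
        ((∫ θ in Set.pi Set.univ fun _ => Set.Icc (0 : ℝ) (2 * π),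
            Real.exp (J * ∑ b : TorusSite 3 L × Fin 3,
              Real.cos (θ (b.1 + Pi.single b.2 1) - θ b.1))) * (L : ℝ) ^ 6) := by
  -- the XY weight `w` and the constant `a = e^{-3JL³}` relating it to the weight of (10.38)
  set w : (TorusSite 3 L → ℝ) → ℝ := fun θ => Real.exp (J * ∑ b : TorusSite 3 L × Fin 3,
    Real.cos (θ (b.1 + Pi.single b.2 1) - θ b.1)) with hw
  have hwc : Continuous w := by
    rw [hw]
    fun_prop
  set a : ℝ := Real.exp (-(3 * J * (L : ℝ) ^ 3)) with ha
  have ha0 : a ≠ 0 := (Real.exp_pos _).ne'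
  have hexp : ∀ θ : TorusSite 3 L → ℝ, Real.exp (-nVectorHamiltonian (J / 2)
      (fun x => (![Real.cos (θ x), Real.sin (θ x)] : Fin 2 → ℝ))) = a * w θ := by
    intro θ
    rw [nVectorHamiltonian_cosSin, ha, hw, ← Real.exp_add]
    congr 1
    ring
  have h1 : Continuous fun ω : VecConfig 3 L 2 =>
      Real.exp (-nVectorHamiltonian (J / 2) ω) * magnetisationNormSq ω :=
    (continuous_nVectorHamiltonian _).neg.rexp.mul NVector.continuous_magnetisationNormSq
  have h2 : Continuous fun ω : VecConfig 3 L 2 => Real.exp (-nVectorHamiltonian (J / 2) ω) :=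
    (continuous_nVectorHamiltonian _).neg.rexp
  rw [NVector.integral_nVectorGibbs _ (map_angleLaw_ne_zero continuous_cosSin.measurable)
      (by positivity : (0 : ℝ) ≤ J / 2),
    nVectorPartitionFunction, integral_nVectorRef_map_angleLaw continuous_cosSin _ h1,
    integral_nVectorRef_map_angleLaw continuous_cosSin _ h2]
  simp_rw [hexp, magnetisationNormSq_cosSin]
  have hpt : ∀ θ : TorusSite 3 L → ℝ,
      a * w θ * ((∑ x, ∑ y, Real.cos (θ x - θ y)) / (L : ℝ) ^ 6) =
        a * ((∑ x, ∑ y, Real.cos (θ x - θ y) * w θ) / (L : ℝ) ^ 6) := by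
    intro θ
    simp_rw [← Finset.sum_mul]
    ring
  simp_rw [hpt]
  have hint : ∀ x y : TorusSite 3 L,
      Integrable (fun θ : TorusSite 3 L → ℝ => Real.cos (θ x - θ y) * w θ)
        (volume.restrict (Set.pi Set.univ fun _ => Set.Icc (0 : ℝ) (2 * π))) := fun x y =>
    integrableOn_angleCube (by fun_prop)
  rw [integral_const_mul, integral_div, integral_const_mul,
    integral_finsetSum _ fun x _ => integrable_finsetSum _ fun y _ => hint x y]
  rw [mul_div_mul_left _ _ ha0, div_div, mul_comm ((L : ℝ) ^ 6)]
  congr 1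
  exact Finset.sum_congr rfl fun x _ => integral_finsetSum _ fun y _ => hint x y

end CosSin

/-! ### The dispersion sum as the torus Green function at the origin -/

section Green

variable {L : ℕ}

/-- `L⁻³ ∑_{k ≠ 0} ε(2πk/L)⁻¹ = torusGreen 0` on `(ℤ/Lℤ)³`. [folklore] -/
theorem inv_mul_sum_inv_dispersion_eq_torusGreen [NeZero L] :
    1 / (L : ℝ) ^ 3 * ∑ k ∈ Finset.univ.erase (0 : TorusSite 3 L),
        1 / dispersion (latticeMomentum L k) = torusGreen (0 : TorusSite 3 L) := by
  rw [torusGreen]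
  have hcos : ∀ k : TorusSite 3 L,
      Real.cos (∑ i, latticeMomentum L k i * (((0 : TorusSite 3 L) i).val : ℝ)) = 1 := by
    intro k
    simp
  simp_rw [hcos]
  ring

/-- `Torus.proj L 0 = 0`. [folklore] -/
theorem torusProj_zero (L : ℕ) : Torus.proj L (0 : Site 3) = 0 := by
  funext i
  simp [Torus.proj]

/-- Each nonzero mode contributes at least `1/6` to the dispersion sum: `0 < ε(2πk/L) ≤ 6` for
`k ≠ 0` in `d = 3`. [folklore] -/
theorem inv_dispersion_ge [NeZero L] {k : TorusSite 3 L} (hk : k ≠ 0) :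
    (1 : ℝ) / 6 ≤ 1 / dispersion (latticeMomentum L k) := by
  have hpos : 0 < dispersion (latticeMomentum L k) :=
    lt_of_le_of_ne (dispersion_nonneg _)
      fun h => hk ((dispersion_latticeMomentum_eq_zero_iff_holds k).1 h.symm)
  have hle : dispersion (latticeMomentum L k) ≤ 6 := by
    unfold dispersion
    calc ∑ i : Fin 3, (1 - Real.cos (latticeMomentum L k i))
        ≤ ∑ _i : Fin 3, (2 : ℝ) := Finset.sum_le_sum fun i _ => by
          linarith [Real.neg_one_le_cos (latticeMomentum L k i)]
      _ = 6 := by norm_num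
  exact one_div_le_one_div_of_le hpos hle

/-- **`torusGreen 0 ≥ 1/12`** on `(ℤ/Lℤ)³`, `L ≥ 2`: the `L³ − 1` nonzero modes each contribute at
least `1/6`. [folklore] -/
theorem torusGreen_zero_ge [NeZero L] (hL : 2 ≤ L) :
    (1 : ℝ) / 12 ≤ torusGreen (0 : TorusSite 3 L) := by
  rw [← inv_mul_sum_inv_dispersion_eq_torusGreen]
  have hcard : ((Finset.univ.erase (0 : TorusSite 3 L)).card : ℝ) = (L : ℝ) ^ 3 - 1 := by
    rw [Finset.card_erase_of_mem (Finset.mem_univ _), Finset.card_univ, card_torusSite,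
      Nat.cast_sub (Nat.one_le_pow _ _ (Nat.pos_of_ne_zero (NeZero.ne L)))]
    push_cast
    ring
  have hsum : ((L : ℝ) ^ 3 - 1) * (1 / 6) ≤
      ∑ k ∈ Finset.univ.erase (0 : TorusSite 3 L), 1 / dispersion (latticeMomentum L k) := by
    rw [← hcard, ← nsmul_eq_mul, ← Finset.sum_const]
    exact Finset.sum_le_sum fun k hk => inv_dispersion_ge (Finset.ne_of_mem_erase hk)
  have hL2 : (2 : ℝ) ≤ L := by exact_mod_cast hL
  have hL3 : (8 : ℝ) ≤ (L : ℝ) ^ 3 := by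
    have h := pow_le_pow_left₀ (by norm_num : (0 : ℝ) ≤ 2) hL2 3
    norm_num at h
    exact h
  have hLpos : (0 : ℝ) < (L : ℝ) ^ 3 := by linarith
  rw [one_div_mul_eq_div, le_div_iff₀ hLpos]
  linarith

/-- **`β₀ > 0`**: the lattice Green function of `ℤ³` at the origin is positive (indeed `≥ 1/12`),
as the limit along even `L` of `torusGreen 0 ≥ 1/12`. [folklore] -/
theorem latticeGreen_zero_pos_three : 0 < latticeGreen (0 : Site 3) := by
  by_contra hneg
  rw [not_lt] at hneg
  obtain ⟨L₀, hL₀⟩ :=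
    torusGreen_tendsto_latticeGreen (d := 3) le_rfl (0 : Site 3) (ε := 1 / 24) (by norm_num)
  haveI : NeZero (2 * L₀ + 2) := ⟨by omega⟩
  have h := hL₀ (2 * L₀ + 2) ⟨L₀ + 1, by ring⟩ (by omega)
  rw [torusProj_zero] at h
  have hge := torusGreen_zero_ge (L := 2 * L₀ + 2) (by omega)
  linarith [(abs_le.1 h).2]

end Green

end PlaneRotator

/-! ### The discharge -/

/-- **Long-range order of the three-dimensional plane rotator at low temperature, proved**
(Friedli–Velenik 2017, Thm. 10.25 with Thm. 10.24, (10.40)–(10.42) and Example 10.22; originally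
Fröhlich–Simon–Spencer 1976): the named fact `FriedliVelenik2017_thm1025_planeRotator3` holds, with
the printed threshold `J₀ = 2β₀ = latticeGreen 0 = ∫_{[-π,π]³} ε(p)⁻¹ dp/(2π)³`
(`β₀ = (ν/4d)∫{1 − (2d)⁻¹∑_{j∼0}cos(p·j)}⁻¹ dp/(2π)^d = (ν/4)·latticeGreen 0`, `ν = 2`, `J = 2β`).
Proof as printed: the finite-volume bound `⟨‖m_L‖²⟩_{L;β} ≥ 1 − (ν/4β)L⁻³∑_{k≠0}ε(2πk/L)⁻¹`
(display after Thm. 10.24; the tree's `FriedliVelenik2017_nVector_infraredBound_holds`, clause (2),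
applied to the uniform law on the circle, Example 10.22), the Riemann-sum limit (10.41)
(`torusGreen_tendsto_latticeGreen`, `d = 3`), and the change of variables between angle fields on
`[0,2π]^{𝕋_L}` and unit-vector configurations
(`PlaneRotator.integral_magnetisationNormSq_nVectorGibbs_cosSin`).
[cite: FriedliVelenikSMLS2017, Thm 10.25 (pp. 502–503) with Thm 10.24, (10.40)–(10.42), Example 10.22] -/
theorem FriedliVelenik2017_thm1025_planeRotator3_holds :
    FriedliVelenik2017_thm1025_planeRotator3 := by
  refine ⟨latticeGreen (0 : Site 3), PlaneRotator.latticeGreen_zero_pos_three,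
    fun J hJ ε hε => ?_⟩
  have hJpos : 0 < J := PlaneRotator.latticeGreen_zero_pos_three.trans hJ
  obtain ⟨L₀, hL₀⟩ :=
    torusGreen_tendsto_latticeGreen (d := 3) le_rfl (0 : Site 3) (ε := ε * J) (by positivity)
  refine ⟨L₀, fun L _ hL0 hLe hL4 => ?_⟩
  dsimp only
  -- (10.41): the Riemann sum is eventually within `εJ` of its limit `latticeGreen 0 = J₀`
  have hG : torusGreen (0 : TorusSite 3 L) ≤ latticeGreen (0 : Site 3) + ε * J := by
    have h := hL₀ L hLe hL0
    rw [PlaneRotator.torusProj_zero] at h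
    linarith [(abs_le.1 h).2]
  -- the finite-volume long-range-order bound (display after Thm. 10.24), `ν = 2`, `β = J/2`,
  -- for the uniform law on the circle (Example 10.22)
  have hfact := (FriedliVelenik2017_nVector_infraredBound_holds 3 L 2 hLe hL4
    (Measure.map (fun t : ℝ => (![Real.cos t, Real.sin t] : Fin 2 → ℝ))
      (volume.restrict (Set.Icc (0 : ℝ) (2 * π))))
    (PlaneRotator.exists_isCompact_map_angleLaw PlaneRotator.continuous_cosSin)
    (PlaneRotator.map_angleLaw_ne_zero PlaneRotator.continuous_cosSin.measurable) (J / 2)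
    (by positivity)).2
    (PlaneRotator.ae_map_angleLaw PlaneRotator.continuous_cosSin PlaneRotator.sum_cosSin_sq)
  rw [PlaneRotator.inv_mul_sum_inv_dispersion_eq_torusGreen,
    PlaneRotator.integral_magnetisationNormSq_nVectorGibbs_cosSin hJpos] at hfact
  have hcoef : ((2 : ℕ) : ℝ) / (4 * (J / 2)) * torusGreen (0 : TorusSite 3 L) =
      torusGreen (0 : TorusSite 3 L) / J := by
    push_cast
    field_simp
    ring
  rw [hcoef] at hfact
  have hdiv : torusGreen (0 : TorusSite 3 L) / J ≤ latticeGreen (0 : Site 3) / J + ε := by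
    rw [div_le_iff₀ hJpos, add_mul, div_mul_cancel₀ _ hJpos.ne']
    exact hG
  exact le_trans (by linarith) hfact

end Literature.Probability.LatticeModels
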